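import Literature.AnabelianGeometry.EtaleTheta.TemperedFrobenioidRestrict
import Literature.AnabelianGeometry.EtaleTheta.TemperedFrobenioidOfKummerTateTower
import Literature.AnabelianGeometry.EtaleTheta.TemperedFrobenioidOfGaloisCoveringCosetTateTower
import Literature.AnabelianGeometry.EtaleTheta.Discharge.Sec3RealifiedCuspidalWeak

/-!
# [EtTh] Def. 3.6 (v) "cuspidally pure" HOLDS at every rank-one object of every Def. 3.3 (iii) datum — hence at the
# tempered Frobenioids of record (Kummer–Tate tower, coset Tate tower, one-component coset model) and over `B^temp(Π)⁰`

S. Mochizuki, *The étale theta function and its Frobenioid-theoretic manifestations*, Publ. RIMS **45** (2009)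
[MochizukiEtTh2009], Def. 3.6 (v) p. 304 (PDF p. 78): "`Φ` is *cuspidally pure* if (a) for every non-cuspidal primary
element `x ∈ Φ(A)` … there exists `y ∈ Φ^{bs-fld}(A)` such that `x ≤ y`; (b) `Prime(Φ(A)) = Prime(Φ(A))^ncsp ∪
Prime(Φ(A))^csp` [disjoint union]"; Def. 3.6 (iii) p. 303 (PDF p. 77) (non-cuspidal / cuspidal elements and primes);
Def. 3.1 (i) p. 296 (PDF p. 70) (log-divisors are supported in "the union of the special fiber and divisor of cusps");
Rmk. 3.3.1 p. 299 (PDF p. 73) (the primes of `Φ₀(Y)` are the Galois orbits of prime log-divisors); Example 3.9 (iii)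
p. 310 (PDF p. 84): "`Φ_W^ell` is … cuspidally pure [cf. the well-known structure of the special fibers of the 'universal
combinatorial coverings']"; Prop. 5.1 p. 323 (PDF p. 97) ("… whose divisor monoid `Φ(−)` is … cuspidally pure").
[cite: MochizukiEtTh2009, Def 3.6 p.78] [cite: MochizukiEtTh2009, Ex 3.9 p.84]

abc-iut cell, block C, K4 / C-R33 row (M6) EtTh:Prop5.1 ⟸ F-0615 (abc-iut-L2-lead R788/R817), seat abc-iut-f-128 (gen 5) —
PHASE 2, the NON-VACUITY half: print's Example 3.9 (iii) clause "`Φ_W^ell` is cuspidally pure" (to which the companion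
`Discharge/Sec5Prop51NodeReclosed.lean` re-keys the node's F-0615 binder) was inhabited in the tree only at one-object TOYS
(abc-iut-L2-t3's `Toy.isCuspidallyPure`, abc-iut-f-137's `CuspFlip.isCuspidallyPure`, abc-iut-w5-d164 / abc-iut-f-144's
`Toy.example39_iv_cuspidallyPure_toy`).  PROOF-ONLY companion (0 definitions, no instance, no new `Prop`) of
abc-iut-w5-d179's `dm`-generic rank-one engine `TemperedFrobenioid.ofRankOneObject` (`TemperedFrobenioidOfRankOneObject.lean`),
abc-iut-L2-d2's v2 model of record `TateTowerKummer.temperedFrobenioid` (`TemperedFrobenioidOfKummerTateTower.lean`),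
abc-iut-w5-d179's `TateTowerCoset.temperedFrobenioid` / `OneCompCoset.temperedFrobenioid`, abc-iut-L2-t3 / abc-iut-L6-t12's
weak Def. 3.6 (i) constructor `RealifiedDivisorMonoids.ofRlfZWeak` and support calculus (`Discharge/Sec3RealifiedCuspidalWeak.lean`),
and `TemperedFrobenioid.restrict[OfFSMType|ConnectedPart]` (`TemperedFrobenioidRestrict.lean`).  Nothing landed is edited.

WHAT IS PROVED.
* `TemperedFrobenioid.IsCuspidallyPure.restrict` / `.restrictOfFSMType` / `.restrictConnectedPart` — Def. 3.6 (v) is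
  OBJECTWISE in `(Φ(A) ⊆ Φ₀^ℝ(Y_A), ncspR, cspR, ℝ·Φ₀^cnst at Y_A)`, so it passes to the Def. 3.6 (ii) data restricted along any
  functor of base categories (`Φ|_{D′}`, base `D′ → D → D₀`) — the general form of Example 3.9 (iv)'s "it follows immediately"
  for `Φ_α^ell := Φ_W^ell|_{D_α}`.
* Weak support calculus at an EMPTY part: `RealifiedDivisorMonoids.toRSuppOfWeak_bot` (no prime arises from `N = 1`),
  `ofRlfZWeak_eq_one_of_mem_cspR_of_csp₀_eq_bot` / `ofRlfZWeak_eq_one_of_mem_ncspR_of_ncsp₀_eq_bot` (if no log-divisor of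
  `Φ₀(Y)` is cuspidal, the only cuspidal element of `Φ₀^ℝ(Y)` is `1`; dually), and at a FULL part:
  `ofRlfZWeak_mem_ncspR_of_mem_pfImage_of_ncsp₀_eq_top` / `…cspR…` (if every log-divisor is non-cuspidal, every element of
  `im(Φ₀(Y)^pf → Φ₀(Y)^rlf)` is non-cuspidal — supports are invariant under powers; dually).
* **`DivisorMonoids.RankOneObject.ncsp₀_csp₀_dichotomy`** — at a rank-one object `Y₀` (`Φ₀(Y₀) ≅ ℕ`, one Galois orbit of
  prime log-divisors, Rmk. 3.3.1) Def. 3.3 (iii)'s UNIQUE factorisation "non-cuspidal × cuspidal" (`existsUnique_ncsp_csp`,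
  Def. 3.1 (i)) forces the generator to be non-cuspidal or cuspidal, whence `(ncsp₀, csp₀)(Y₀) = (⊤, ⊥)` or `(⊥, ⊤)`: the one
  prime of `Φ₀(Y₀)` lies in the special fibre or is a cusp, never both, exactly as in print.
* **`TemperedFrobenioid.isCuspidallyPure_ofRankOneObject`** — Def. 3.6 (v) HOLDS, WITH NO HYPOTHESIS, for the tempered
  Frobenioid `ofRankOneObject P hpf R S` over ANY Def. 3.3 (iii) datum `dm` at ANY rank-one object `P` (weak vocabulary of
  record, `Λ = ℤ`): (a) by the engine's "`Φ^{bs-fld} = Φ`" (`of_mem_cnstR_of_mem_pfImage`: `y := x`), vacuous in the cuspidal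
  case; (b) the unique prime of `Φ ≅ ℚ_{≥0}` is non-cuspidal (resp. cuspidal) according to the dichotomy, and not both (a
  primary element is `≠ 1`).  `…_ofRankOneObjectConnectedPart` — the same over print's genuine base `B^temp(Π)⁰`, every `Π`.
* **AT THE MODELS OF RECORD**: `TateTowerKummer.isCuspidallyPure_temperedFrobenioid` (abc-iut-L2-d2's v2 model of record, the
  Kummer–Tate tower at its base point), `TateTowerCoset.isCuspidallyPure_temperedFrobenioid` (abc-iut-w6-d058's Tate tower,
  coset data), `OneCompCoset.isCuspidallyPure_temperedFrobenioid` (one-component model, every coset object) — and their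
  `B^temp(Π)⁰` re-basings: the "cuspidally pure" clause of Example 3.9 (iii) / Prop. 5.1 is a THEOREM at every tempered
  Frobenioid of record built by the rank-one engine.

HONEST LABEL: at a rank-one object the dichotomy is one-sided BY CONSTRUCTION (`Φ₀(Y₀)` has a single prime — at the towers
of record it is the orbit `Σ_j [F_j]` of special-fibre components, so every divisor is non-cuspidal and (a) is witnessed by
`div(ϖⁿ)`); a datum where (a) and (b) are both exercised with cusps present (a `Φ₀(Y)` of rank ≥ 2 with a cuspidal orbit,
e.g. abc-iut-L2-t3's `TateTowerTheta.model` once a tempered Frobenioid over it exists, L2-lead R818) is NOT claimed here.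
Consistency / instantiation witnesses over CONSTRUCTED data, not the tempered Frobenioid of a Tate curve; [EtTh] is
refereed; nothing here bears on [IUTchIII] Cor. 3.12 — no side is taken; typed ≠ proved for anything else.
-/

noncomputable section

namespace Literature.AnabelianGeometry.EtaleTheta

open CategoryTheory Opposite Function Literature.AlgebraicGeometry.Frobenioids Literature.AnabelianGeometry.SemiGraphs

universe u₀ v₀ u v u' v' w

/-! ### 0. Def. 3.6 (v) passes to restricted Def. 3.6 (ii) data -/

namespace TemperedFrobenioid

namespace IsCuspidallyPure

section Restrict

variable {D₀ : Type u₀} [Category.{v₀} D₀] {V : FrdIMonoidStub.{w}} {T : RealifiedDivisorMonoids (D₀ := D₀) V}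
  {D : Type u} [Category.{v} D] {IsRational IsStrictlyRational : (Dᵒᵖ ⥤ CommMonCat.{w}) → Prop}
  {C : TemperedFrobenioid T D (treeCatVocab D IsRational IsStrictlyRational)}
  {D' : Type u'} [Category.{v'} D'] (G : D' ⥤ D)
  (IsRational' IsStrictlyRational' : (D'ᵒᵖ ⥤ CommMonCat.{w}) → Prop)

/-- **Def. 3.6 (v) is inherited by restriction along a functor of base categories**: if `Φ` on `D → D₀` is cuspidally
pure, so is `Φ|_{D′}` on `D′ → D → D₀` — the conditions at `A′ ∈ Ob(D′)` are literally the conditions at `G A′`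
(Example 3.9 (iv): "`Φ_α^ell := Φ_W^ell|_{D_α}` … cuspidally pure … it follows immediately").
[cite: MochizukiEtTh2009, Def 3.6 p.78] -/
theorem restrict (hp : C.IsCuspidallyPure) (hc : IsConnected D') (hte : IsTotallyEpimorphic D')
    (hG : ∀ {A B : D'} (f : B ⟶ A), IsFSM f → IsFSM (G.map f)) :
    (C.restrict G IsRational' IsStrictlyRational' hc hte hG).IsCuspidallyPure where
  exists_bsFld_dvd A x hx hnc := by
    obtain ⟨y, hy, hxy⟩ := hp.exists_bsFld_dvd (G.op.obj A) x hx hnc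
    exact ⟨y, hy, hxy⟩
  ncsp_or_csp A 𝔭 := hp.ncsp_or_csp (G.op.obj A) 𝔭
  not_ncsp_and_csp A 𝔭 := hp.not_ncsp_and_csp (G.op.obj A) 𝔭

/-- Def. 3.6 (v) is inherited by restriction along a functor from a base of FSM-type.
[cite: MochizukiEtTh2009, Def 3.6 p.78] -/
theorem restrictOfFSMType (hp : C.IsCuspidallyPure) (hc : IsConnected D') (hte : IsTotallyEpimorphic D')
    (hD' : IsOfFSMType D') :
    (C.restrictOfFSMType G IsRational' IsStrictlyRational' hc hte hD').IsCuspidallyPure :=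
  hp.restrict G IsRational' IsStrictlyRational' hc hte fun f hf => by
    haveI := hD'.isIso_of_isFSM f hf
    exact IsFSM.of_isIso (G.map f)

end Restrict

section ConnectedPartBase

variable {D₀ : Type u₀} [Category.{v₀} D₀] {V : FrdIMonoidStub.{w}} {T : RealifiedDivisorMonoids (D₀ := D₀) V}
  {D : Type u} [Category.{v} D] {IsRational IsStrictlyRational : (Dᵒᵖ ⥤ CommMonCat.{w}) → Prop}
  {C : TemperedFrobenioid T D (treeCatVocab D IsRational IsStrictlyRational)}
  (Γ : Type u') [Group Γ] [TopologicalSpace Γ] (G : ConnectedPart (BTemp Γ) ⥤ D)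
  (IsRational' IsStrictlyRational' : ((ConnectedPart (BTemp Γ))ᵒᵖ ⥤ CommMonCat.{w}) → Prop)

/-- Def. 3.6 (v) is inherited by the re-basing to print's genuine base `B^temp(Π)⁰`.
[cite: MochizukiEtTh2009, Def 3.6 p.78] -/
theorem restrictConnectedPart (hp : C.IsCuspidallyPure) :
    (C.restrictConnectedPart Γ G IsRational' IsStrictlyRational').IsCuspidallyPure :=
  hp.restrictOfFSMType G IsRational' IsStrictlyRational' _ _ _

end ConnectedPartBase

end IsCuspidallyPure

end TemperedFrobenioid

/-! ### 1. Weak support calculus at an empty / full (non-)cuspidal part -/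

namespace RealifiedDivisorMonoids

variable {D₀ : Type u} [Category.{v} D₀] (dm : DivisorMonoids.{u, v, w} D₀)
  (hpf : ∀ Y : D₀ᵒᵖ, IsPerfFactorialCof (dm.Φ₀.obj Y))

/-- No prime of `Φ₀(Y)` "arises from" the trivial submonoid `N = 1 ⊆ Φ₀(Y)` (`ι(1) = 1` has empty support; weak data).
[cite: MochizukiEtTh2009, Def 3.6 p.77] -/
theorem toRSuppOfWeak_bot (Y : D₀ᵒᵖ) : toRSuppOfWeak dm hpf Y ⊥ = ∅ := by
  rw [Set.eq_empty_iff_forall_notMem]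
  intro 𝔮 h
  rw [toRSuppOfWeak, Set.mem_iUnion₂] at h
  obtain ⟨a, ha, h𝔮⟩ := h
  rw [SetLike.mem_coe, Submonoid.mem_bot] at ha
  subst ha
  change ((hpf Y).weak.toRealification (Perfection.of _ (1 : dm.Φ₀.obj Y))).1 𝔮 ≠ 1 at h𝔮
  rw [map_one, map_one] at h𝔮
  exact h𝔮 rfl

/-- If NO log-divisor of `Φ₀(Y)` is cuspidal (`csp₀(Y) = 1`), the only cuspidal element of `Φ₀^ℝ(Y)` is `1` (weak data
`ofRlfZWeak`). [cite: MochizukiEtTh2009, Def 3.6 p.77] -/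
theorem ofRlfZWeak_eq_one_of_mem_cspR_of_csp₀_eq_bot (Y : D₀ᵒᵖ) (h0 : dm.csp₀ Y = ⊥) {x : (hpf Y).weak.Rlf}
    (hx : x ∈ (ofRlfZWeak dm hpf).cspR Y) : x = 1 := by
  change supp ((hpf Y).weak.realification.subtype x) ⊆ toRSuppOfWeak dm hpf Y (dm.csp₀ Y) at hx
  rw [h0, toRSuppOfWeak_bot] at hx
  exact Subtype.ext (eq_one_of_supp_subset_empty hx)

/-- Dually: if NO log-divisor of `Φ₀(Y)` is non-cuspidal (`ncsp₀(Y) = 1`), the only non-cuspidal element of `Φ₀^ℝ(Y)` is `1`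
(weak data `ofRlfZWeak`). [cite: MochizukiEtTh2009, Def 3.6 p.77] -/
theorem ofRlfZWeak_eq_one_of_mem_ncspR_of_ncsp₀_eq_bot (Y : D₀ᵒᵖ) (h0 : dm.ncsp₀ Y = ⊥) {x : (hpf Y).weak.Rlf}
    (hx : x ∈ (ofRlfZWeak dm hpf).ncspR Y) : x = 1 := by
  change supp ((hpf Y).weak.realification.subtype x) ⊆ toRSuppOfWeak dm hpf Y (dm.ncsp₀ Y) at hx
  rw [h0, toRSuppOfWeak_bot] at hx
  exact Subtype.ext (eq_one_of_supp_subset_empty hx)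

/-- If EVERY log-divisor of `Φ₀(Y)` is non-cuspidal (`ncsp₀(Y) = Φ₀(Y)`), every element of `im(Φ₀(Y)^pf → Φ₀(Y)^rlf)` is
non-cuspidal in `Φ₀^ℝ(Y)` (`ι^pf(a)^n = ι(m)` for `a = m^{1/n}`, and the non-cuspidal part is root-closed; weak data).
[cite: MochizukiEtTh2009, Def 3.6 p.77] -/
theorem ofRlfZWeak_mem_ncspR_of_mem_pfImage_of_ncsp₀_eq_top (Y : D₀ᵒᵖ) (htop : dm.ncsp₀ Y = ⊤)
    {x : (hpf Y).weak.Rlf} (hx : x ∈ MonoidHom.mrange (hpf Y).weak.toRealification) :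
    x ∈ (ofRlfZWeak dm hpf).ncspR Y := by
  obtain ⟨a, rfl⟩ := hx
  obtain ⟨⟨m, n⟩, rfl⟩ := Perfection.mk_surjective a
  apply (ofRlfZWeak_pow_mem_ncspR_iff dm hpf Y _ n.ne_zero).mp
  rw [← map_pow, Perfection.mk_pow_self]
  exact (ofRlfZWeak dm hpf).toR_ncsp Y m (htop ▸ Submonoid.mem_top m)

/-- Dually: if EVERY log-divisor of `Φ₀(Y)` is cuspidal, every element of `im(Φ₀(Y)^pf → Φ₀(Y)^rlf)` is cuspidal
(weak data). [cite: MochizukiEtTh2009, Def 3.6 p.77] -/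
theorem ofRlfZWeak_mem_cspR_of_mem_pfImage_of_csp₀_eq_top (Y : D₀ᵒᵖ) (htop : dm.csp₀ Y = ⊤)
    {x : (hpf Y).weak.Rlf} (hx : x ∈ MonoidHom.mrange (hpf Y).weak.toRealification) :
    x ∈ (ofRlfZWeak dm hpf).cspR Y := by
  obtain ⟨a, rfl⟩ := hx
  obtain ⟨⟨m, n⟩, rfl⟩ := Perfection.mk_surjective a
  apply (ofRlfZWeak_pow_mem_cspR_iff dm hpf Y _ n.ne_zero).mp
  rw [← map_pow, Perfection.mk_pow_self]
  exact (ofRlfZWeak dm hpf).toR_csp Y m (htop ▸ Submonoid.mem_top m)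

end RealifiedDivisorMonoids

/-! ### 2. Rank-one objects: the generator is non-cuspidal or cuspidal -/

namespace DivisorMonoids

namespace RankOneObject

variable {D₀ : Type u₀} [Category.{v₀} D₀] {dm : DivisorMonoids.{u₀, v₀, 0} D₀} (P : dm.RankOneObject)

/-- Every log-divisor over a rank-one object is a power of the generator `e⁻¹(1)`. [cite: MochizukiEtTh2009, Rmk 3.3.1 p.73] -/
theorem eq_gen_pow (m : dm.Φ₀.obj (op P.Y₀)) :
    m = P.e.symm (Multiplicative.ofAdd 1) ^ (Multiplicative.toAdd (P.e m) : ℕ) := by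
  apply P.e.injective
  rw [map_pow, P.e.apply_symm_apply, ← ofAdd_nsmul, smul_eq_mul, mul_one, ofAdd_toAdd]

/-- **The generator of `Φ₀(Y₀) ≅ ℕ` is non-cuspidal or cuspidal** (Def. 3.3 (iii)'s unique factorisation
"non-cuspidal × cuspidal" of an irreducible element). [cite: MochizukiEtTh2009, Def 3.3 p.73] -/
theorem gen_mem_ncsp₀_or_mem_csp₀ :
    P.e.symm (Multiplicative.ofAdd 1) ∈ dm.ncsp₀ (op P.Y₀) ∨ P.e.symm (Multiplicative.ofAdd 1) ∈ dm.csp₀ (op P.Y₀) := by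
  obtain ⟨⟨n, c⟩, hnc, -⟩ := dm.existsUnique_ncsp_csp (op P.Y₀) (P.e.symm (Multiplicative.ofAdd 1))
  have h := congrArg (fun m => Multiplicative.toAdd (P.e m)) hnc
  simp only [map_mul, toAdd_mul, MulEquiv.apply_symm_apply, toAdd_ofAdd] at h
  rcases Nat.eq_zero_or_pos (Multiplicative.toAdd (P.e (c : dm.Φ₀.obj (op P.Y₀)))) with hc0 | hcpos
  · -- `c = 1`, so the generator is `n`, non-cuspidal
    have hc1 : (c : dm.Φ₀.obj (op P.Y₀)) = 1 := by
      rw [← P.e.map_eq_one_iff, ← ofAdd_toAdd (P.e (c : dm.Φ₀.obj (op P.Y₀))), hc0, ofAdd_zero]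
    left
    rw [← hnc, hc1, mul_one]
    exact n.2
  · -- `n = 1`, so the generator is `c`, cuspidal
    have hn0 : Multiplicative.toAdd (P.e (n : dm.Φ₀.obj (op P.Y₀))) = 0 := by omega
    have hn1 : (n : dm.Φ₀.obj (op P.Y₀)) = 1 := by
      rw [← P.e.map_eq_one_iff, ← ofAdd_toAdd (P.e (n : dm.Φ₀.obj (op P.Y₀))), hn0, ofAdd_zero]
    right
    rw [← hnc, hn1, one_mul]
    exact c.2

/-- **At a rank-one object, `(ncsp₀, csp₀) = (Φ₀, 1)` or `(1, Φ₀)`**: the single prime of `Φ₀(Y₀)` lies in the special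
fibre or is a cusp, and by the uniqueness of the "non-cuspidal × cuspidal" factorisation not both.
[cite: MochizukiEtTh2009, Def 3.3 p.73] -/
theorem ncsp₀_csp₀_dichotomy :
    (dm.ncsp₀ (op P.Y₀) = ⊤ ∧ dm.csp₀ (op P.Y₀) = ⊥) ∨ (dm.ncsp₀ (op P.Y₀) = ⊥ ∧ dm.csp₀ (op P.Y₀) = ⊤) := by
  rcases P.gen_mem_ncsp₀_or_mem_csp₀ with hg | hg
  · have htop : dm.ncsp₀ (op P.Y₀) = ⊤ := by
      rw [eq_top_iff]
      intro m _
      rw [P.eq_gen_pow m]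
      exact pow_mem hg _
    refine Or.inl ⟨htop, ?_⟩
    rw [eq_bot_iff]
    intro c hc
    rw [Submonoid.mem_bot]
    obtain ⟨p, -, huniq⟩ := dm.existsUnique_ncsp_csp (op P.Y₀) c
    have h₁ := huniq (⟨c, htop ▸ Submonoid.mem_top c⟩, 1) (by simp)
    have h₂ := huniq (1, ⟨c, hc⟩) (by simp)
    have h := congrArg (fun q : dm.ncsp₀ (op P.Y₀) × dm.csp₀ (op P.Y₀) => (q.1 : dm.Φ₀.obj (op P.Y₀))) (h₁.trans h₂.symm)
    simpa using h
  · have htop : dm.csp₀ (op P.Y₀) = ⊤ := by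
      rw [eq_top_iff]
      intro m _
      rw [P.eq_gen_pow m]
      exact pow_mem hg _
    refine Or.inr ⟨?_, htop⟩
    rw [eq_bot_iff]
    intro n hn
    rw [Submonoid.mem_bot]
    obtain ⟨p, -, huniq⟩ := dm.existsUnique_ncsp_csp (op P.Y₀) n
    have h₁ := huniq (⟨n, hn⟩, 1) (by simp)
    have h₂ := huniq (1, ⟨n, htop ▸ Submonoid.mem_top n⟩) (by simp)
    have h := congrArg (fun q : dm.ncsp₀ (op P.Y₀) × dm.csp₀ (op P.Y₀) => (q.1 : dm.Φ₀.obj (op P.Y₀))) (h₁.trans h₂.symm)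
    simpa using h

end RankOneObject

end DivisorMonoids

/-! ### 3. Def. 3.6 (v) at the rank-one engine, hypothesis-free -/

namespace TemperedFrobenioid

section RankOne

variable {D₀ : Type u₀} [Category.{v₀} D₀] {dm : DivisorMonoids.{u₀, v₀, 0} D₀} (P : dm.RankOneObject)
  (hpf : ∀ Y : D₀ᵒᵖ, IsPerfFactorialCof (dm.Φ₀.obj Y)) (R S : ((Discrete PUnit.{1})ᵒᵖ ⥤ CommMonCat.{0}) → Prop)

/-- **Def. 3.6 (v) HOLDS for the tempered Frobenioid at ANY rank-one object of ANY Def. 3.3 (iii) datum** (abc-iut-w5-d179's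
engine `ofRankOneObject`; no hypothesis): if the generator of `Φ₀(Y₀)` is non-cuspidal, every element of
`Φ = im(Φ₀^pf → Φ₀^rlf)` is non-cuspidal, (a) holds with `y := x` ("`Φ^{bs-fld} = Φ`") and the prime of `Φ` is non-cuspidal and
not cuspidal (a cuspidal element is `1`, a primary one is not); if it is cuspidal, dually, with (a) vacuous.
[cite: MochizukiEtTh2009, Def 3.6 p.78] -/
theorem isCuspidallyPure_ofRankOneObject : (ofRankOneObject P hpf R S).IsCuspidallyPure := by
  rcases P.ncsp₀_csp₀_dichotomy with ⟨hN, hC⟩ | ⟨hN, hC⟩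
  · refine ⟨fun A x _ _ => ⟨x, ?_, dvd_rfl⟩, fun A 𝔭 => Or.inl fun x _ => ?_, fun A 𝔭 h => ?_⟩
    · exact Submonoid.mem_inf.mpr ⟨x.2, Submonoid.mem_comap.mpr (P.of_mem_cnstR_of_mem_pfImage hpf x.2)⟩
    · exact RealifiedDivisorMonoids.ofRlfZWeak_mem_ncspR_of_mem_pfImage_of_ncsp₀_eq_top dm hpf (op P.Y₀) hN x.2
    · obtain ⟨-, hcsp⟩ := h
      obtain ⟨⟨a, ha⟩, rfl⟩ := Quotient.mk_surjective 𝔭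
      have hmem : a ∈ Primes.carrier (Quotient.mk (primarySetoid _) ⟨a, ha⟩) := ⟨ha, rfl⟩
      exact ha.1 (Subtype.ext
        (RealifiedDivisorMonoids.ofRlfZWeak_eq_one_of_mem_cspR_of_csp₀_eq_bot dm hpf (op P.Y₀) hC (hcsp a hmem)))
  · refine ⟨fun A x hx hnc => ?_, fun A 𝔭 => Or.inr fun x _ => ?_, fun A 𝔭 h => ?_⟩
    · exact absurd (Subtype.ext
        (RealifiedDivisorMonoids.ofRlfZWeak_eq_one_of_mem_ncspR_of_ncsp₀_eq_bot dm hpf (op P.Y₀) hN hnc)) hx.1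
    · exact RealifiedDivisorMonoids.ofRlfZWeak_mem_cspR_of_mem_pfImage_of_csp₀_eq_top dm hpf (op P.Y₀) hC x.2
    · obtain ⟨hncsp, -⟩ := h
      obtain ⟨⟨a, ha⟩, rfl⟩ := Quotient.mk_surjective 𝔭
      have hmem : a ∈ Primes.carrier (Quotient.mk (primarySetoid _) ⟨a, ha⟩) := ⟨ha, rfl⟩
      exact ha.1 (Subtype.ext
        (RealifiedDivisorMonoids.ofRlfZWeak_eq_one_of_mem_ncspR_of_ncsp₀_eq_bot dm hpf (op P.Y₀) hN (hncsp a hmem)))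

variable (Γ : Type) [Group Γ] [TopologicalSpace Γ] (R' S' : ((ConnectedPart (BTemp Γ))ᵒᵖ ⥤ CommMonCat.{0}) → Prop)

/-- **… and over print's genuine base `B^temp(Π)⁰`** (the engine's `ofRankOneObjectConnectedPart`), for every topological
group `Π`. [cite: MochizukiEtTh2009, Def 3.6 p.78] -/
theorem isCuspidallyPure_ofRankOneObjectConnectedPart :
    (ofRankOneObjectConnectedPart P hpf R S Γ R' S').IsCuspidallyPure :=
  (isCuspidallyPure_ofRankOneObject P hpf R S).restrictConnectedPart Γ _ R' S'

end RankOne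

end TemperedFrobenioid

/-! ### 4. The models of record -/

namespace TateTowerKummer

variable (R S : ((Discrete PUnit.{1})ᵒᵖ ⥤ CommMonCat.{0}) → Prop)
  (Γ : Type) [Group Γ] [TopologicalSpace Γ] (R' S' : ((ConnectedPart (BTemp Γ))ᵒᵖ ⥤ CommMonCat.{0}) → Prop)

/-- **Def. 3.6 (v) at abc-iut-L2-d2's v2 MODEL OF RECORD** (the Kummer–Tate tower at its base point): the divisor monoid of
`TateTowerKummer.temperedFrobenioid` is cuspidally pure. [cite: MochizukiEtTh2009, Def 3.6 p.78] -/
theorem isCuspidallyPure_temperedFrobenioid : (temperedFrobenioid R S).IsCuspidallyPure :=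
  TemperedFrobenioid.isCuspidallyPure_ofRankOneObject rankOneObject hpf R S

/-- … and for its re-basing over `B^temp(Π)⁰`. [cite: MochizukiEtTh2009, Def 3.6 p.78] -/
theorem isCuspidallyPure_ofRankOneObjectConnectedPart :
    (TemperedFrobenioid.ofRankOneObjectConnectedPart rankOneObject hpf R S Γ R' S').IsCuspidallyPure :=
  TemperedFrobenioid.isCuspidallyPure_ofRankOneObjectConnectedPart rankOneObject hpf R S Γ R' S'

end TateTowerKummer

namespace TateTowerCoset

variable (R S : ((Discrete PUnit.{1})ᵒᵖ ⥤ CommMonCat.{0}) → Prop)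
  (Γ : Type) [Group Γ] [TopologicalSpace Γ] (R' S' : ((ConnectedPart (BTemp Γ))ᵒᵖ ⥤ CommMonCat.{0}) → Prop)

/-- **Def. 3.6 (v) at the MODEL OF RECORD, coset data** (abc-iut-w6-d058's Tate tower, `G = ℤ`, object `G/G`): the divisor monoid
of `TateTowerCoset.temperedFrobenioid` is cuspidally pure. [cite: MochizukiEtTh2009, Def 3.6 p.78] -/
theorem isCuspidallyPure_temperedFrobenioid : (temperedFrobenioid R S).IsCuspidallyPure :=
  TemperedFrobenioid.isCuspidallyPure_ofRankOneObject rankOneObject hpf R S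

/-- … and for its re-basing over `B^temp(Π)⁰`. [cite: MochizukiEtTh2009, Def 3.6 p.78] -/
theorem isCuspidallyPure_ofRankOneObjectConnectedPart :
    (TemperedFrobenioid.ofRankOneObjectConnectedPart rankOneObject hpf R S Γ R' S').IsCuspidallyPure :=
  TemperedFrobenioid.isCuspidallyPure_ofRankOneObjectConnectedPart rankOneObject hpf R S Γ R' S'

end TateTowerCoset

namespace OneCompCoset

variable (U : Type) [CommGroup U] (hU : ∀ u : U, (∀ N : ℕ+, ∃ g : U, g ^ (N : ℕ) = u) → u = 1)
  (R S : ((Discrete PUnit.{1})ᵒᵖ ⥤ CommMonCat.{0}) → Prop) (H : Subgroup PUnit.{1})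

/-- **Def. 3.6 (v) at the one-component coset model** (`G = 1`, every object `G/H`): the divisor monoid of
`OneCompCoset.temperedFrobenioid` is cuspidally pure. [cite: MochizukiEtTh2009, Def 3.6 p.78] -/
theorem isCuspidallyPure_temperedFrobenioid : (temperedFrobenioid U hU R S H).IsCuspidallyPure :=
  TemperedFrobenioid.isCuspidallyPure_ofRankOneObject (rankOneObject U hU H) (hpf U hU) R S

end OneCompCoset

end Literature.AnabelianGeometry.EtaleTheta

end
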